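import Summits.MatrixMultiplication.OmegaCensus.C2QuaternionLawModSixFourAll
import Summits.MatrixMultiplication.OmegaCensus.DihedralLikeModel
import Summits.MatrixMultiplication.OmegaCensus.C2DihedralLowerBound
import HarnessLib

/-!
# `β(C₂ × (ℤ_n ⋊ ℤ₄)) = 16⌊2n/3⌋` for every even `n ≥ 14`

ω-census, family (b3).  Framing: lottery ticket; floor = certified bounds/negative ranges.

`ℤ_n ⋊ ℤ₄ = G(ℤ₂ × ℤ_n, (1,0))` (`DihedralLikeModel.lean`; `β(ℤ_n ⋊ ℤ₄) = 8⌊2n/3⌋`, `CyclicSemidirectZ4Law.lean`), and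
`C₂ × (ℤ_n ⋊ ℤ₄) = Multiplicative (ZMod 2) × DihedralLikeGroup (ZMod 2 × ZMod n) (1,0)` is the dicyclic-type group
`G(ℤ₂ × ℤ₂ × ℤ_n, (0,1,0))` with `|A| = 4n` (`c2_semidirect_presentation`).  For EVEN `n` the quotient
`A/⟨c₀⟩ ≅ ℤ₂ × ℤ_n` is not cyclic (`z2_z2_zn_quot_noncyclic`), so for `n ≡ 1 (mod 3)` (`|A| ≡ 1 (mod 3)`) the P3
exclusion gives `V ≤ law − 8 = (32n − 32)/3` (`tpp_volume_dicyclic_quot_noncyclic_le`); for `n ≡ 2 (mod 3)` the dicyclic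
law gives `V ≤ (32n − 16)/3`, for `3 ∣ n` the general law `V ≤ 32n/3`.  In all three cases this is `16⌊2n/3⌋ = 2β(ℤ_n ⋊ ℤ₄)`,
attained by the product of `(C₂, 1, 1)` with the lifted dihedral family (`c2_semidirect_volume_ge`):
**`c2_semidirect_law`: β(C₂ × (ℤ_n ⋊ ℤ₄)) = 16⌊2n/3⌋ for every even `n ≥ 14`** (for odd `n`, `ℤ_n ⋊ ℤ₄ ≅ Q_{4n}`:
see `C2QuaternionLaw*.lean`, where `C₂ × Q_{4m}` exceeds `2β(Q_{4m})` exactly for `m ≡ 1 (mod 6)`).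
-/

namespace Summit.MatrixMultiplication.OmegaCensus

open Literature.Combinatorics.Additive Finset
open Summit.MatrixMultiplication.MatrixMultiplication.Theorems.JuntaBranch.Planting (tpp_product)

section C2SD

variable {n : ℕ} [NeZero n]

omit [NeZero n] in
/-- The presentation of `C₂ × (ℤ_n ⋊ ℤ₄)` as `G(ℤ₂ × (ℤ₂ × ℤ_n), (0,(1,0)))`, packaged. [folklore] -/
theorem c2_semidirect_presentation
    {P : Prop}
    (K : ∀ (ρ τ : ZMod 2 × (ZMod 2 × ZMod n) →
        Multiplicative (ZMod 2) × DihedralLikeGroup (ZMod 2 × ZMod n) ((1 : ZMod 2), 0))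
      (c₀ : ZMod 2 × (ZMod 2 × ZMod n)),
      (∀ a b, ρ a * ρ b = ρ (a + b)) → (∀ a b, ρ a * τ b = τ (b - a)) → (∀ a b, τ a * ρ b = τ (a + b)) →
      (∀ a b, τ a * τ b = ρ (c₀ + b - a)) → Function.Injective ρ → Function.Injective τ → (∀ a b, ρ a ≠ τ b) →
      (∀ g, (∃ a, ρ a = g) ∨ (∃ a, τ a = g)) → c₀ = ((0 : ZMod 2), (((1 : ZMod 2), (0 : ZMod n)))) → P) : P :=
  K (fun p => (Multiplicative.ofAdd p.1, DihedralLikeGroup.rho p.2))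
    (fun p => (Multiplicative.ofAdd p.1, DihedralLikeGroup.tau p.2))
    ((0 : ZMod 2), (((1 : ZMod 2), (0 : ZMod n))))
    (fun a b => by
      simp only [Prod.mk_mul_mk, DihedralLikeGroup.rho_mul_rho, ← ofAdd_add, Prod.fst_add, Prod.snd_add])
    (fun a b => by
      simp only [Prod.mk_mul_mk, DihedralLikeGroup.rho_mul_tau, ← ofAdd_add, Prod.fst_sub, Prod.snd_sub]
      rw [sub_eq_add_neg b.1, ZMod.neg_eq_self_mod_two, add_comm b.1])
    (fun a b => by
      simp only [Prod.mk_mul_mk, DihedralLikeGroup.tau_mul_rho, ← ofAdd_add, Prod.fst_add, Prod.snd_add])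
    (fun a b => by
      simp only [Prod.mk_mul_mk, DihedralLikeGroup.tau_mul_tau, ← ofAdd_add, Prod.fst_sub, Prod.snd_sub, Prod.fst_add,
        Prod.snd_add, zero_add]
      rw [sub_eq_add_neg b.1, ZMod.neg_eq_self_mod_two, add_comm b.1])
    (fun a b hab => by
      simp only [Prod.mk.injEq, DihedralLikeGroup.rho.injEq] at hab
      exact Prod.ext (Multiplicative.ofAdd.injective hab.1) hab.2)
    (fun a b hab => by
      simp only [Prod.mk.injEq, DihedralLikeGroup.tau.injEq] at hab
      exact Prod.ext (Multiplicative.ofAdd.injective hab.1) hab.2)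
    (fun a b hab => by simp at hab)
    (fun g => by
      obtain ⟨i, q⟩ := g
      cases q with
      | rho j => exact Or.inl ⟨(Multiplicative.toAdd i, j), rfl⟩
      | tau j => exact Or.inr ⟨(Multiplicative.toAdd i, j), rfl⟩)
    rfl

/-- For even `n`, `c₀ = (0,(1,0))` is non-zero in `A = ℤ₂ × (ℤ₂ × ℤ_n)` and `A/⟨c₀⟩ ≅ ℤ₂ × ℤ_n` is not cyclic
(no `g` with `A = ⟨g⟩ ∪ (c₀ + ⟨g⟩)`; project to `ℤ₂ × ℤ_n`). [folklore] -/
theorem z2_z2_zn_quot_noncyclic (hn2 : 2 ∣ n) :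
    (((0 : ZMod 2), (((1 : ZMod 2), (0 : ZMod n)))) : ZMod 2 × (ZMod 2 × ZMod n)) ≠ 0 ∧
    ¬ ∃ g : ZMod 2 × (ZMod 2 × ZMod n), ∀ x, x ∈ AddSubgroup.zmultiples g ∨
      x + ((0 : ZMod 2), (((1 : ZMod 2), (0 : ZMod n)))) ∈ AddSubgroup.zmultiples g := by
  refine ⟨fun h => ?_, ?_⟩
  · have h1 : ((1 : ZMod 2)) = 0 := congrArg (fun p : ZMod 2 × (ZMod 2 × ZMod n) => p.2.1) h
    exact one_ne_zero h1
  · rintro ⟨g, hg⟩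
    apply not_cyclic_zmod_two_prod (k := n) hn2
    refine ⟨(g.1, g.2.2), fun y => ?_⟩
    have key : ∀ e : ZMod 2, ((y.1, (e, y.2)) : ZMod 2 × (ZMod 2 × ZMod n)) ∈ AddSubgroup.zmultiples g →
        y ∈ AddSubgroup.zmultiples (g.1, g.2.2) := by
      intro e he
      obtain ⟨k, hk⟩ := AddSubgroup.mem_zmultiples_iff.1 he
      refine AddSubgroup.mem_zmultiples_iff.2 ⟨k, ?_⟩
      have h1 := congrArg Prod.fst hk
      have h2 := congrArg (fun p : ZMod 2 × (ZMod 2 × ZMod n) => p.2.2) hk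
      simp only [Prod.smul_fst, Prod.smul_snd] at h1 h2
      exact Prod.ext h1 h2
    rcases hg (y.1, (0, y.2)) with h | h
    · exact key 0 h
    · refine key 1 ?_
      have e : ((y.1, ((0 : ZMod 2), y.2)) : ZMod 2 × (ZMod 2 × ZMod n)) + (0, (1, 0)) = (y.1, (1, y.2)) :=
        Prod.ext (add_zero _) (Prod.ext (zero_add _) (add_zero _))
      rw [e] at h; exact h

/-- **Upper bound**: for even `n ≥ 14` every TPP triple of `C₂ × (ℤ_n ⋊ ℤ₄)` has `|S||T||U| ≤ 16⌊2n/3⌋`. [folklore] -/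
theorem c2_semidirect_tpp_volume_le (hn2 : 2 ∣ n) (hn : 14 ≤ n)
    {S T U : Finset (Multiplicative (ZMod 2) × DihedralLikeGroup (ZMod 2 × ZMod n) ((1 : ZMod 2), 0))}
    (h : TripleProductProperty S T U) : S.card * T.card * U.card ≤ 16 * (2 * n / 3) := by
  obtain ⟨hc₀, hnq⟩ := z2_z2_zn_quot_noncyclic (n := n) hn2
  refine c2_semidirect_presentation (n := n) fun ρ τ c₀ hρρ hρτ hτρ hττ hρ hτ hne hsurj hc => ?_
  subst hc
  have hcard : Fintype.card (ZMod 2 × (ZMod 2 × ZMod n)) = 4 * n := by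
    rw [Fintype.card_prod, Fintype.card_prod, ZMod.card, ZMod.card]; ring
  have h2c := two_c0_eq_zero hρτ hτρ hττ hτ
  by_cases h1 : n % 3 = 1
  · have key := tpp_volume_dicyclic_quot_noncyclic_le hρρ hρτ hτρ hττ hc₀ hnq hρ hτ hne hsurj (by rw [hcard]; omega)
      (by rw [hcard]; omega) h
    rw [hcard] at key
    omega
  by_cases h2 : n % 3 = 2
  · have key := tpp_volume_le_law_dicyclicLike hρρ hρτ hτρ hττ hρ hτ hne hsurj h2c hc₀ (by rw [hcard]; omega)
      (by rw [hcard]; omega) h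
    rw [hcard] at key
    omega
  · have key := tpp_volume_le_of_dihedralLike hρρ hρτ hτρ hττ hρ hτ hne hsurj h
    rw [hcard] at key
    omega

/-- **Lower bound**: `β(C₂ × (ℤ_n ⋊ ℤ₄)) ≥ 16⌊2n/3⌋ = 2β(ℤ_n ⋊ ℤ₄)` (`n ≥ 3`): the product of `(C₂, 1, 1)` with the lifted
dihedral family. [folklore] -/
theorem c2_semidirect_volume_ge (hn : 3 ≤ n) :
    ∃ S T U : Finset (Multiplicative (ZMod 2) × DihedralLikeGroup (ZMod 2 × ZMod n) ((1 : ZMod 2), 0)),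
      TripleProductProperty S T U ∧ S.card * T.card * U.card = 16 * (2 * n / 3) := by
  obtain ⟨S, T, U, h, hvol⟩ := z2zn_volume_ge_law (n := n) (ε := 1) hn
  refine ⟨univ ×ˢ S, {1} ×ˢ T, {1} ×ˢ U, tpp_product tpp_univ_one_one h, ?_⟩
  rw [card_product, card_product, card_product, card_univ, card_singleton, Fintype.card_multiplicative, ZMod.card]
  calc 2 * S.card * (1 * T.card) * (1 * U.card) = 2 * (S.card * T.card * U.card) := by ring
    _ = 16 * (2 * n / 3) := by rw [hvol]; ring

/-- **`β(C₂ × (ℤ_n ⋊ ℤ₄)) = 16⌊2n/3⌋ = 2β(ℤ_n ⋊ ℤ₄)` for every even `n ≥ 14`** (both halves kernel). [folklore] -/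
theorem c2_semidirect_law (hn2 : 2 ∣ n) (hn : 14 ≤ n) :
    (∀ S T U : Finset (Multiplicative (ZMod 2) × DihedralLikeGroup (ZMod 2 × ZMod n) ((1 : ZMod 2), 0)),
        TripleProductProperty S T U → S.card * T.card * U.card ≤ 16 * (2 * n / 3)) ∧
    ∃ S T U : Finset (Multiplicative (ZMod 2) × DihedralLikeGroup (ZMod 2 × ZMod n) ((1 : ZMod 2), 0)),
      TripleProductProperty S T U ∧ S.card * T.card * U.card = 16 * (2 * n / 3) :=
  ⟨fun _ _ _ h => c2_semidirect_tpp_volume_le hn2 hn h, c2_semidirect_volume_ge (by omega)⟩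

end C2SD

end Summit.MatrixMultiplication.OmegaCensus
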